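import Literature.AlgebraicGeometry.Resolution.AnalyticallyUnramifiedDescent
import Literature.AlgebraicGeometry.Resolution.CompleteLocalJapanese
import Literature.AlgebraicGeometry.Resolution.NormalizationFiniteGlobal
import Literature.AlgebraicGeometry.Resolution.ExcellentRingsCompleteProofs
import Literature.AlgebraicGeometry.Resolution.ExcellentRingsCompleteHolds
import Literature.AlgebraicGeometry.Resolution.GeneralLUProofs
import Literature.AlgebraicGeometry.Resolution.QuasiExcellentLocalization
import Literature.AlgebraicGeometry.Resolution.RegularHomReduced
import Literature.AlgebraicGeometry.Resolution.RegularLocalRingsNormal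
import Literature.AlgebraicGeometry.Resolution.RegularLocalRingsQuotient
import Mathlib.RingTheory.Localization.AtPrime.Basic
import HarnessLib

/-!
# Algebras of finite type over a complete Noetherian local ring have finite normalization (EGA IV₂ 7.7.4) — proof

Topic: `Literature/AlgebraicGeometry/Resolution`. PROOF of the named fact
`EGAIV2_7_7_4_finiteNormalization_completeLocal` (`FiniteNormalizationCompleteLocalBase.lean`; EGA
IV₂ Cor. (7.7.4), second assertion, in the formulation (7.7.1)): for a complete Noetherian local
ring `A` and an `A`-algebra of finite type `B` which is a domain, the integral closure of `B` in
`Frac B` is a finite `B`-module. EGA: *"La seconde [assertion] résulte de (7.6.4) et (7.7.2)"*;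
we follow the arrangement of the Stacks Project (Tags 07PV, 07QK, 032Y, 032W, 0BI1):

1. `B` is a G-ring: complete Noetherian local rings are G-rings (Matsumura 32.3,
   `isGRing_of_isAdicComplete`) and finite type algebras over G-rings are G-rings
   (`Stacks07PV_holds`); every local ring `B_𝔭` is a G-ring (`isGRing_of_isLocalization`), hence
   analytically unramified (`IsGRing.isReduced_adicCompletion`, Stacks 07QK).
2. `B_𝔭` is N-1 (`module_finite_integralClosure_localization_of_isGRing`): the complete local
   domains `(B_𝔭)^/𝔮` are N-1 by Nagata's theorem (`CompleteLocalJapanese.lean`, through Tate's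
   theorem `TateJapanese*.lean` and Cohen's structure theorem), and finiteness descends
   (`AnalyticallyUnramifiedDescent.lean`, Stacks 10.162.10).
3. Globalisation (Stacks 10.161.15, `NormalizationFiniteGlobal.lean`): `B` is J-2
   (`isJ2Ring_of_isAdicComplete`, `IsJ2Ring.of_finiteType`), so the regular locus of `Spec B` is
   an open neighbourhood of the generic point and there is `f ≠ 0` with `B_𝔭` regular, hence
   normal, for `f ∉ 𝔭`; therefore `fⁿ B' ⊆ B` elementwise, and the local finiteness at every prime
   gives the finiteness of `B'`.

No definitions, no named facts; the discharge `EGAIV2_7_7_4_finiteNormalization_completeLocal_holds`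
is appended to the fact file.

## References

* [EGAIV2] A. Grothendieck, J. Dieudonné, EGA IV₂, Publ. Math. IHÉS 24 (1965), (7.6.4), (7.7.2),
  Cor. (7.7.4) p. 213.
* [StacksProject] The Stacks Project, Tags 07PV, 07QK, 032Y, 032W, 0BI1 (10.161.15).
-/

noncomputable section

open IsLocalRing

namespace Literature.AlgebraicGeometry.Resolution

universe u

/-! ## Step 2: the local rings of a G-ring domain are N-1 -/

/-- **The local rings of a Noetherian G-ring domain are N-1**: for `B` a domain which is a G-ring
and `𝔭` a prime, the integral closure of `B_𝔭` in its field of fractions is a finite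
`B_𝔭`-module. (`B_𝔭` is a local G-ring, so `(B_𝔭)^` is reduced — Stacks 07QK; its quotients by
minimal primes are complete local domains, N-1 by Stacks 10.162.8; descent 10.162.10.)
[cite: StacksProject, Tag 032Y (Lemma 10.162.10 (5))] [cite: StacksProject, Tag 032W] -/
theorem module_finite_integralClosure_localization_of_isGRing {B : Type u} [CommRing B]
    [IsDomain B] (hG : IsGRing B) (𝔭 : Ideal B) [𝔭.IsPrime] :
    Module.Finite (Localization.AtPrime 𝔭)
      (integralClosure (Localization.AtPrime 𝔭) (FractionRing (Localization.AtPrime 𝔭))) := by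
  haveI : IsNoetherianRing B := hG.1
  haveI : IsDomain (Localization.AtPrime 𝔭) :=
    IsLocalization.isDomain_localization 𝔭.primeCompl_le_nonZeroDivisors
  have hGp : IsGRing (Localization.AtPrime 𝔭) := isGRing_of_isLocalization 𝔭.primeCompl hG
  haveI : IsNoetherianRing (Localization.AtPrime 𝔭) := hGp.1
  have hred : IsReduced (AdicCompletion (maximalIdeal (Localization.AtPrime 𝔭))
      (Localization.AtPrime 𝔭)) := hGp.isReduced_adicCompletion
  refine module_finite_integralClosure_of_isReduced_adicCompletion_of_minimalPrimes hred
    fun 𝔮 h𝔮 => ?_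
  haveI : IsNoetherianRing (AdicCompletion (maximalIdeal (Localization.AtPrime 𝔭))
      (Localization.AtPrime 𝔭)) := isNoetherianRing_adicCompletion_maximalIdeal _
  haveI : 𝔮.IsPrime := h𝔮.1.1
  haveI : IsLocalRing (AdicCompletion (maximalIdeal (Localization.AtPrime 𝔭))
      (Localization.AtPrime 𝔭) ⧸ 𝔮) := isLocalRing_quotient (Ideal.IsPrime.ne_top inferInstance)
  haveI : IsAdicComplete (maximalIdeal (AdicCompletion (maximalIdeal (Localization.AtPrime 𝔭))
      (Localization.AtPrime 𝔭) ⧸ 𝔮)) (AdicCompletion (maximalIdeal (Localization.AtPrime 𝔭))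
      (Localization.AtPrime 𝔭) ⧸ 𝔮) := isAdicComplete_quotient 𝔮
  exact module_finite_integralClosure_fractionRing_of_isAdicComplete _

/-! ## Step 3: globalisation -/

section Global

variable {B : Type u} [CommRing B] [IsDomain B]

/-- If `B_𝔭` is integrally closed for every prime `𝔭` not containing `f`, then every element of
`Frac B` integral over `B` is of the form `b/fⁿ` ("Note that `R_f = R'_f` since `R_f` is already
normal"). [cite: StacksProject, Tag 0BI1 (proof of Lemma 10.161.15)] -/
theorem exists_pow_smul_mem_of_isIntegrallyClosed_localization (f : B)
    (hf : ∀ 𝔭 : Ideal B, [𝔭.IsPrime] → f ∉ 𝔭 → IsIntegrallyClosed (Localization.AtPrime 𝔭))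
    (y : FractionRing B) (hy : IsIntegral B y) :
    ∃ (n : ℕ) (b : B), algebraMap B (FractionRing B) b = f ^ n • y := by
  classical
  let J : Ideal B := (LinearMap.range (Algebra.linearMap B (FractionRing B))).colon {y}
  have hJ : f ∈ J.radical := by
    rw [Ideal.radical_eq_sInf, Submodule.mem_sInf]
    rintro 𝔭 ⟨hJ𝔭, h𝔭⟩
    by_contra hf𝔭
    haveI := h𝔭
    haveI := hf 𝔭 hf𝔭
    have hy' : IsIntegral (Localization.AtPrime 𝔭) y := hy.tower_top
    obtain ⟨w, hw⟩ := IsIntegrallyClosed.isIntegral_iff.mp hy'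
    obtain ⟨⟨b, s⟩, hbs⟩ := IsLocalization.mk'_surjective (Ideal.primeCompl 𝔭) w
    simp only at hbs
    subst hbs
    have hs : (s : B) ∈ J := by
      rw [Submodule.mem_colon_singleton, ← hw]
      refine ⟨b, ?_⟩
      change algebraMap B (FractionRing B) b = (s : B) • algebraMap _ _ (IsLocalization.mk' _ b s)
      rw [Algebra.smul_def, IsScalarTower.algebraMap_apply B (Localization.AtPrime 𝔭) (FractionRing B) b,
        IsScalarTower.algebraMap_apply B (Localization.AtPrime 𝔭) (FractionRing B) (s : B), ← map_mul,
        IsLocalization.mk'_spec']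
    exact s.2 (hJ𝔭 hs)
  obtain ⟨n, hn⟩ := hJ
  obtain ⟨b, hb⟩ := Submodule.mem_colon_singleton.mp hn
  exact ⟨n, b, hb⟩

/-- **Local finite generation of the normalization, transported to `Frac B`**: if the integral
closure of `B_𝔭` in its own field of fractions is finite over `B_𝔭`, then finitely many elements
of `B' ⊆ Frac B` generate `B'` locally at `𝔭`. [cite: StacksProject, Tag 0BI1 (proof of Lemma
10.161.15: "we can find finitely many elements `x_1, …, x_n ∈ K` integral over `R` such that
`R'_𝔪` is generated by `x_1, …, x_n` over `R_𝔪`")] -/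
theorem exists_finset_locally_generates_integralClosure (𝔭 : Ideal B) [𝔭.IsPrime]
    (h : Module.Finite (Localization.AtPrime 𝔭)
      (integralClosure (Localization.AtPrime 𝔭) (FractionRing (Localization.AtPrime 𝔭)))) :
    ∃ S : Finset (FractionRing B),
      (S : Set (FractionRing B)) ⊆ Subalgebra.toSubmodule (integralClosure B (FractionRing B)) ∧
      ∀ y ∈ Subalgebra.toSubmodule (integralClosure B (FractionRing B)), ∃ s ∉ 𝔭,
        s • y ∈ Submodule.span B (S : Set (FractionRing B)) := by
  classical
  set Bp := Localization.AtPrime 𝔭 with hBp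
  set K := FractionRing B with hK
  haveI : IsDomain Bp := IsLocalization.isDomain_localization 𝔭.primeCompl_le_nonZeroDivisors
  -- transport the finiteness to the integral closure of `B_𝔭` inside `K`
  let e : FractionRing Bp ≃ₐ[Bp] K := FractionRing.algEquiv Bp K
  haveI := h
  haveI hfinK : Module.Finite Bp (integralClosure Bp K) := by
    have heq : (integralClosure Bp (FractionRing Bp)).map (e : FractionRing Bp →ₐ[Bp] K) =
        integralClosure Bp K := integralClosure_map_algEquiv e
    have e' := Subalgebra.equivMapOfInjective (integralClosure Bp (FractionRing Bp))
      (e : FractionRing Bp →ₐ[Bp] K) e.injective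
    rw [heq] at e'
    exact Module.Finite.equiv e'.toLinearEquiv
  obtain ⟨T, hT⟩ := Module.Finite.fg_top (R := Bp) (M := integralClosure Bp K)
  -- clear denominators of the generators
  have hmult : ∀ g : integralClosure Bp K, ∃ m : 𝔭.primeCompl, IsIntegral B ((m : B) • (g : K)) :=
    fun g => IsIntegral.exists_multiple_integral_of_isLocalization 𝔭.primeCompl (g : K) g.2
  choose t ht using hmult
  refine ⟨T.image fun g => (t g : B) • (g : K), ?_, ?_⟩
  · intro z hz
    rw [Finset.coe_image] at hz
    obtain ⟨g, -, rfl⟩ := hz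
    exact ht g
  · intro y hy
    have hyint : IsIntegral B y := hy
    have hyBp : (⟨y, hyint.tower_top⟩ : integralClosure Bp K) ∈
        Submodule.span Bp (T : Set (integralClosure Bp K)) := by rw [hT]; exact Submodule.mem_top
    -- predicate: some multiplier outside `𝔭` brings the element into the `B`-span
    let SS : Set K := ((T.image fun g => (t g : B) • (g : K)) : Set K)
    suffices hP : ∀ w ∈ Submodule.span Bp (T : Set (integralClosure Bp K)),
        ∃ s ∉ 𝔭, s • (w : K) ∈ Submodule.span B SS from hP _ hyBp
    intro w hw
    refine Submodule.span_induction ?_ ?_ ?_ ?_ hw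
    · intro g hg
      refine ⟨t g, (t g).2, Submodule.subset_span ?_⟩
      exact Finset.mem_coe.mpr (Finset.mem_image.mpr ⟨g, hg, rfl⟩)
    · exact ⟨1, fun h1 => Ideal.IsPrime.ne_top inferInstance ((Ideal.eq_top_iff_one _).mpr h1),
        by simp⟩
    · rintro w₁ w₂ - - ⟨s₁, hs₁, h₁⟩ ⟨s₂, hs₂, h₂⟩
      refine ⟨s₁ * s₂, fun hmem => (Ideal.IsPrime.mem_or_mem inferInstance hmem).elim hs₁ hs₂, ?_⟩
      rw [Subalgebra.coe_add, smul_add]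
      refine Submodule.add_mem _ ?_ ?_
      · rw [mul_comm, mul_smul]; exact Submodule.smul_mem _ _ h₁
      · rw [mul_smul]; exact Submodule.smul_mem _ _ h₂
    · rintro c w - ⟨s, hs, hsw⟩
      obtain ⟨⟨b, u⟩, hbu⟩ := IsLocalization.mk'_surjective (Ideal.primeCompl 𝔭) c
      simp only at hbu
      subst hbu
      refine ⟨s * u, fun hmem => (Ideal.IsPrime.mem_or_mem inferInstance hmem).elim hs u.2, ?_⟩
      have key : (u : B) • ((IsLocalization.mk' Bp b u) • (w : K)) = b • (w : K) := by
        rw [← smul_assoc, Algebra.smul_def (u : B) (IsLocalization.mk' Bp b u),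
          IsLocalization.mk'_spec', IsScalarTower.algebraMap_smul]
      rw [Subalgebra.coe_smul, mul_smul, key, smul_comm]
      exact Submodule.smul_mem _ _ hsw

end Global

/-! ## The theorem -/

/-- **EGA IV₂ Cor. (7.7.4) (second assertion, complete local case, formulation (7.7.1)) —
PROVED**: for a complete Noetherian local ring `A` and an `A`-algebra of finite type `B` which is
a domain, the integral closure of `B` in `Frac B` is a finite `B`-module.
[cite: EGAIV2, Cor. (7.7.4) p. 213 with (7.7.1) p. 212] [cite: StacksProject, Tag 0BI1 (Lemma 10.161.15)] -/
theorem EGAIV2_7_7_4_finiteNormalization_completeLocal_proof (A B : Type u) [CommRing A]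
    [IsLocalRing A] [IsNoetherianRing A] [IsAdicComplete (maximalIdeal A) A] [CommRing B]
    [IsDomain B] [Algebra A B] (hft : Algebra.FiniteType A B) :
    Module.Finite B (integralClosure B (FractionRing B)) := by
  classical
  haveI := hft
  -- `B` is a G-ring and J-2
  have hG : IsGRing B := Stacks07PV_holds A B (isGRing_of_isAdicComplete A) inferInstance
  haveI : IsNoetherianRing B := hG.1
  have hJ : IsJ2Ring B := (isJ2Ring_of_isAdicComplete A).of_finiteType hft
  -- an `f ≠ 0` with `B_𝔭` regular (hence normal) off `V(f)`
  have hopen : IsOpen (regularLocus B) := hJ.2 B inferInstance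
  let η : PrimeSpectrum B := ⟨⊥, Ideal.isPrime_bot⟩
  have hη : η ∈ regularLocus B := by
    change IsRegularLocalRing (Localization.AtPrime (⊥ : Ideal B))
    haveI : IsDomain (Localization.AtPrime (⊥ : Ideal B)) :=
      IsLocalization.isDomain_localization (Ideal.primeCompl_le_nonZeroDivisors _)
    have hF : IsField (Localization.AtPrime (⊥ : Ideal B)) := by
      rw [IsLocalRing.isField_iff_maximalIdeal_eq, ← Localization.AtPrime.map_eq_maximalIdeal,
        Ideal.map_bot]
    letI := hF.toField
    infer_instance
  obtain ⟨s, hs⟩ := (PrimeSpectrum.isOpen_iff _).mp hopen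
  have hηs : η ∉ PrimeSpectrum.zeroLocus s := by
    rw [← hs]; exact fun h => h hη
  obtain ⟨f, hfs, hfη⟩ : ∃ f ∈ s, f ∉ η.asIdeal := by
    simpa [PrimeSpectrum.mem_zeroLocus, Set.subset_def] using hηs
  have hf0 : f ≠ 0 := fun h => hfη (by rw [h]; exact Submodule.zero_mem _)
  have hfreg : ∀ 𝔭 : Ideal B, [𝔭.IsPrime] → f ∉ 𝔭 →
      IsIntegrallyClosed (Localization.AtPrime 𝔭) := by
    intro 𝔭 _ hf𝔭
    have hmem : (⟨𝔭, inferInstance⟩ : PrimeSpectrum B) ∈ regularLocus B := by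
      rw [← compl_compl (regularLocus B), hs]
      exact fun h => hf𝔭 (h hfs)
    haveI : IsRegularLocalRing (Localization.AtPrime 𝔭) := hmem
    exact isIntegrallyClosed_of_isRegularLocalRing _
  -- globalisation
  let N : Submodule B (FractionRing B) := Subalgebra.toSubmodule (integralClosure B (FractionRing B))
  have hfN : ∀ y ∈ N, ∃ (n : ℕ) (b : B), algebraMap B (FractionRing B) b = f ^ n • y :=
    fun y hy => exists_pow_smul_mem_of_isIntegrallyClosed_localization f hfreg y hy
  have hloc : ∀ 𝔭 : PrimeSpectrum B, ∃ S : Finset (FractionRing B),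
      (S : Set (FractionRing B)) ⊆ N ∧
      ∀ y ∈ N, ∃ s ∉ 𝔭.asIdeal, s • y ∈ Submodule.span B (S : Set (FractionRing B)) :=
    fun 𝔭 => exists_finset_locally_generates_integralClosure 𝔭.asIdeal
      (module_finite_integralClosure_localization_of_isGRing hG 𝔭.asIdeal)
  exact Module.Finite.iff_fg.mpr (fg_of_forall_prime_locally_fg N hf0 hfN hloc)

end Literature.AlgebraicGeometry.Resolution

end
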